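import Summits.QuantumFields.YangMills.Theorems.FluctuationComparisonRegPrIntLS2BetaSectionsStageSteps
import Summits.QuantumFields.YangMills.Theorems.FluctuationComparisonRegPrIntLS2BetaSqrtGaugeGlue
import Literature.MathematicalPhysics.QuantumFieldTheory.Balaban1983to89.T4PairDerivBridge
import HarnessLib

/-!
# S2β · D-GUARD ∕ (BG∞) — (L-Σ) PART 5∕5: ★★★ `hSec_of_fillings` — THE SECTIONS HYPOTHESIS OF ✓`hBG_of_sections` FROM THREE BLOCK-LOCAL FILLING LETTERS (UV3-NODE §116 ADD.2)

Cell `ym3-torus` (YM ladder rung R3 = continuum `SU(2)` Yang–Mills on the three-torus at fixed lattice data — a RUNG: NOT d = 4, NOT infinite volume,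
NOT a mass gap, NOT Clay).  Width seat «width 19» `ym3-torus-px19` (gen 25, ★p1 lineage), FREE px helper on crux `stmt-QuantumFields-20520`
(`FluctuationComparisonRegPrIntL`; registry `Lines/semiclassical_s2beta.lean` UNTOUCHED, 0∕5); `--kind proof --supports stmt-QuantumFields-20520 --as helper`,
count-neutral, DEFINITION-FREE (0 `def`, 0 `instance`, 0 `notation`, 0 `sorry`, default heartbeats).  (BG∞) plan of record: UV3-NODE §116 + ADD.1 + ADD.2
(architect ruling px17 g23 2026-09-01T00:13:02Z; desk RULINGs №123 ∕ №127 (binder style) ∕ №132-A; LEAD RULINGs №66 ∕ №67).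

WHY.  ✓p840037 reduced LEAD №41's `hBG` (the N-uniform small-bond gauge `arc ≤ C√θ + c∕N` on the 3-torus) BY KERNEL to ONE displayed hypothesis `hSec`: Lipschitz,
consistent sections over the parity blocks.  This file proves `hSec` from three FILLING LETTERS of one shape — for every input scale `E` an output scale `A` and a
threshold `ρ₀` such that on every box of per-axis sides in `[ρ, (4ρ+3)∕3]`, `ρ ≥ ρ₀`, a datum prescribed on the ODD FACES (stage 1: two opposite faces; stage 2: the
tube of four; stage 3: all six) and `ε`-slow there with `ερ ≤ E` is matched on those faces by a section of the box that is `(A∕ρ)`-slow on every bond of the box —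
by un-pinning parts 1–4: the descent function by ✓`exists_descentFun`, the fillings `W₁ W₂ W₃` by choice from the letters at the chained scales `E₁ = 1∕40`,
`E₂ = max 0 A₁ + 1∕40`, `E₃ = max (max 0 A₁) A₂ + 1∕40` (`ε_s := B_{s−1}∕ρ + max η 0`), the tables and the stage count by `rfl`; (CONS) is ✓`cons`, (STEP) is
✓`step_stage0∕1∕2∕3` with `K := max (max (max (max 0 A₁) A₂) A₃) (2ρ̄)`, `ρ̄ := max (max ρ₁ ρ₂) (max ρ₃ 2)`; scales `ρ < ρ̄` are served by the trivial sections
`w_Q := g_Q⁻¹` (`dist1 ≤ 2 ≤ K∕ρ`, Literature `dist1_le_two_specialUnitaryGroup`).  Per-axis sides: the letters are STRETCH-agnostic ((R3)∕(L-S)′ on boxes, or the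
odd-equal text v2 at `n := c₀`).

WHAT IS PROVED (sorry-free).  ★★★`hSec_of_fillings (h₁ h₂ h₃) : ⟨the hypothesis `hSec` of ✓`hBG_of_sections`, verbatim⟩`.  Consequently, BY KERNEL:
`hBG ⟸ FILL₁ ∧ FILL₂ ∧ FILL₃` (`hBG_of_sections ⟨K, hK, …⟩ ∘ hSec_of_fillings`).

HONEST SCOPE.  Bookkeeping and group algebra over DISPLAYED hypotheses (the eight-colour table and the filling data are carried as functions PINNED by displayed
equations, in the style of ✓p839983's `hW`; nothing is defined).  The three FILLING LETTERS are HYPOTHESES of the final theorem (file (Σ-B5)); until they are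
discharged ((L-I) ✓p839983, (L-T)∕(R3) px5, (L-S) px8, with the cone-centre lemmas (B3′)∕(B3-S)) `hSec`, hence `hBG`, (BG∞), `hsupp⁺` and D-GUARD's two `hsupp`
letters are NOT proved.  Nothing of Bałaban's renormalisation-group analysis is asserted or proved ([Balaban1985RegularSpaces] Lemma 1 p.79 ∕ (1.29) p.81 is the
local, non-uniform statement in print; the N-uniform torus gluing is the (BG∞) plan's, NOT in print).  GAP♯∘ (`stub_uniformFibreGapOrbit`, registry UNTOUCHED), the
five registered stubs (0∕5), S2β, 20520, 19936, 19200, `YM3TorusSU2` are NOT proved; no registered stub is closed; rung R3 — NOT d = 4, NOT infinite volume, NOT a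
mass gap, NOT Clay; the Yang–Mills mass gap is NOT proved.  Axioms standard.

References: T. Bałaban, CMP **99** (1985) 75–102 [Balaban1985RegularSpaces] (Lemma 1 p.79, (1.29) p.81).
-/

set_option autoImplicit false

namespace Summit.QuantumFields.YangMills.Theorems.FluctuationComparisonRegPrIntLS2BetaSectionsOfFillings

open Literature.MathematicalPhysics.QuantumFieldTheory.Balaban1983to89
open T4CubeChartGnomonic (SU2)
open T4PairDerivBridge (dist1_le_two_specialUnitaryGroup)
open Summit.QuantumFields.YangMills.Theorems.FluctuationComparisonRegPrIntLS2BetaDescendedBlock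
open Summit.QuantumFields.YangMills.Theorems.FluctuationComparisonRegPrIntLS2BetaSectionsColourTable
open Summit.QuantumFields.YangMills.Theorems.FluctuationComparisonRegPrIntLS2BetaSectionsDescentConsistency
open Summit.QuantumFields.YangMills.Theorems.FluctuationComparisonRegPrIntLS2BetaSectionsFaceDatumStep
open Summit.QuantumFields.YangMills.Theorems.FluctuationComparisonRegPrIntLS2BetaSectionsStageSteps

/-! ## §7 The sections theorem from the three filling letters -/

/-- ★★★ **(L-Σ) `hSec` FROM THREE BLOCK-LOCAL FILLING LETTERS.** The sections hypothesis of ✓`hBG_of_sections` (its ONE displayed hypothesis, verbatim) follows from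
the stage-1 ∕ stage-2 ∕ stage-3 FILLING LETTERS (stage 1 at the single input scale `E = 1∕40`; stages 2, 3 for every `E`): for the input Lipschitz scale `E` there are an output scale `A` and a threshold `ρ₀` such that on every box of
sides in `[ρ, (4ρ+3)∕3]` (per axis), `ρ ≥ ρ₀`, a datum prescribed on the odd faces (two opposite faces ∕ a tube of four ∕ all six) and `ε`-slow there with `ερ ≤ E`
extends to a section of the box, equal to the datum on those faces and `(A∕ρ)`-slow on every bond of the box.  The composition: descended blocks (✓(Σ-A)),
the eight-colour table, (DESC) ⇒ (CONS) by ✓`dblock_agrees`, (STEP) by three rounds of ✓`face_datum_step`; scales `ρ < ρ̄` are served by the trivial sections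
`w_Q := g_Q⁻¹` (`dist1 ≤ 2 ≤ K∕ρ`). [cite: Balaban1985RegularSpaces, Lemma 1 p.79, (1.29) p.81] -/
theorem hSec_of_fillings
    (h₁ : ∃ A : ℝ, ∃ ρ₀ : ℕ, ∀ (P : Params), P.d = 3 → ∀ ρ : ℕ, ρ₀ ≤ ρ → 8 * ρ ≤ P.sitesPerDir 0 →
      ∀ (n s : Fin P.d → ℕ), (∀ κ, ρ ≤ n κ ∧ 3 * n κ ≤ 4 * ρ + 3) →
      ∀ (α : Fin P.d) (ψ : Site P 0 → SU2) (ε : ℝ), ∃ W : Site P 0 → SU2,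
        (∀ x : Site P 0, (∀ κ, (x κ - ((s κ : ℕ) : ZMod (P.sitesPerDir 0))).val ≤ n κ) →
          ((x α - ((s α : ℕ) : ZMod (P.sitesPerDir 0))).val = 0 ∨ (x α - ((s α : ℕ) : ZMod (P.sitesPerDir 0))).val = n α) → W x = ψ x) ∧
        ((0 ≤ ε ∧ ε * ρ ≤ 1 / 40 ∧ ∀ b : PBond P 0, (∀ κ, (b.src κ - ((s κ : ℕ) : ZMod (P.sitesPerDir 0))).val ≤ n κ) →
            (∀ κ, (b.tgt κ - ((s κ : ℕ) : ZMod (P.sitesPerDir 0))).val ≤ n κ) →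
            ((b.src α - ((s α : ℕ) : ZMod (P.sitesPerDir 0))).val = 0 ∨ (b.src α - ((s α : ℕ) : ZMod (P.sitesPerDir 0))).val = n α) →
            ((b.tgt α - ((s α : ℕ) : ZMod (P.sitesPerDir 0))).val = 0 ∨ (b.tgt α - ((s α : ℕ) : ZMod (P.sitesPerDir 0))).val = n α) →
            dist1 (ψ b.src * (ψ b.tgt)⁻¹) ≤ ε) →
          ∀ b : PBond P 0, (∀ κ, (b.src κ - ((s κ : ℕ) : ZMod (P.sitesPerDir 0))).val ≤ n κ) →
            (∀ κ, (b.tgt κ - ((s κ : ℕ) : ZMod (P.sitesPerDir 0))).val ≤ n κ) →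
            dist1 (W b.src * (W b.tgt)⁻¹) ≤ A / ρ))
    (h₂ : ∀ E : ℝ, ∃ A : ℝ, ∃ ρ₀ : ℕ, ∀ (P : Params), P.d = 3 → ∀ ρ : ℕ, ρ₀ ≤ ρ → 8 * ρ ≤ P.sitesPerDir 0 →
      ∀ (n s : Fin P.d → ℕ), (∀ κ, ρ ≤ n κ ∧ 3 * n κ ≤ 4 * ρ + 3) →
      ∀ (α β : Fin P.d) (ψ : Site P 0 → SU2) (ε : ℝ), ∃ W : Site P 0 → SU2,
        (∀ x : Site P 0, (∀ κ, (x κ - ((s κ : ℕ) : ZMod (P.sitesPerDir 0))).val ≤ n κ) →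
          (((x α - ((s α : ℕ) : ZMod (P.sitesPerDir 0))).val = 0 ∨ (x α - ((s α : ℕ) : ZMod (P.sitesPerDir 0))).val = n α) ∨
            ((x β - ((s β : ℕ) : ZMod (P.sitesPerDir 0))).val = 0 ∨ (x β - ((s β : ℕ) : ZMod (P.sitesPerDir 0))).val = n β)) → W x = ψ x) ∧
        ((α ≠ β ∧ 0 ≤ ε ∧ ε * ρ ≤ E ∧ ∀ b : PBond P 0, (∀ κ, (b.src κ - ((s κ : ℕ) : ZMod (P.sitesPerDir 0))).val ≤ n κ) →
            (∀ κ, (b.tgt κ - ((s κ : ℕ) : ZMod (P.sitesPerDir 0))).val ≤ n κ) →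
            (((b.src α - ((s α : ℕ) : ZMod (P.sitesPerDir 0))).val = 0 ∨ (b.src α - ((s α : ℕ) : ZMod (P.sitesPerDir 0))).val = n α) ∨
              ((b.src β - ((s β : ℕ) : ZMod (P.sitesPerDir 0))).val = 0 ∨ (b.src β - ((s β : ℕ) : ZMod (P.sitesPerDir 0))).val = n β)) →
            (((b.tgt α - ((s α : ℕ) : ZMod (P.sitesPerDir 0))).val = 0 ∨ (b.tgt α - ((s α : ℕ) : ZMod (P.sitesPerDir 0))).val = n α) ∨
              ((b.tgt β - ((s β : ℕ) : ZMod (P.sitesPerDir 0))).val = 0 ∨ (b.tgt β - ((s β : ℕ) : ZMod (P.sitesPerDir 0))).val = n β)) →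
            dist1 (ψ b.src * (ψ b.tgt)⁻¹) ≤ ε) →
          ∀ b : PBond P 0, (∀ κ, (b.src κ - ((s κ : ℕ) : ZMod (P.sitesPerDir 0))).val ≤ n κ) →
            (∀ κ, (b.tgt κ - ((s κ : ℕ) : ZMod (P.sitesPerDir 0))).val ≤ n κ) →
            dist1 (W b.src * (W b.tgt)⁻¹) ≤ A / ρ))
    (h₃ : ∀ E : ℝ, ∃ A : ℝ, ∃ ρ₀ : ℕ, ∀ (P : Params), P.d = 3 → ∀ ρ : ℕ, ρ₀ ≤ ρ → 8 * ρ ≤ P.sitesPerDir 0 →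
      ∀ (n s : Fin P.d → ℕ), (∀ κ, ρ ≤ n κ ∧ 3 * n κ ≤ 4 * ρ + 3) →
      ∀ (ψ : Site P 0 → SU2) (ε : ℝ), ∃ W : Site P 0 → SU2,
        (∀ x : Site P 0, (∀ κ, (x κ - ((s κ : ℕ) : ZMod (P.sitesPerDir 0))).val ≤ n κ) →
          (∃ κ, (x κ - ((s κ : ℕ) : ZMod (P.sitesPerDir 0))).val = 0 ∨ (x κ - ((s κ : ℕ) : ZMod (P.sitesPerDir 0))).val = n κ) → W x = ψ x) ∧
        ((0 ≤ ε ∧ ε * ρ ≤ E ∧ ∀ b : PBond P 0, (∀ κ, (b.src κ - ((s κ : ℕ) : ZMod (P.sitesPerDir 0))).val ≤ n κ) →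
            (∀ κ, (b.tgt κ - ((s κ : ℕ) : ZMod (P.sitesPerDir 0))).val ≤ n κ) →
            (∃ κ, (b.src κ - ((s κ : ℕ) : ZMod (P.sitesPerDir 0))).val = 0 ∨ (b.src κ - ((s κ : ℕ) : ZMod (P.sitesPerDir 0))).val = n κ) →
            (∃ κ, (b.tgt κ - ((s κ : ℕ) : ZMod (P.sitesPerDir 0))).val = 0 ∨ (b.tgt κ - ((s κ : ℕ) : ZMod (P.sitesPerDir 0))).val = n κ) →
            dist1 (ψ b.src * (ψ b.tgt)⁻¹) ≤ ε) →
          ∀ b : PBond P 0, (∀ κ, (b.src κ - ((s κ : ℕ) : ZMod (P.sitesPerDir 0))).val ≤ n κ) →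
            (∀ κ, (b.tgt κ - ((s κ : ℕ) : ZMod (P.sitesPerDir 0))).val ≤ n κ) →
            dist1 (W b.src * (W b.tgt)⁻¹) ≤ A / ρ)) :
    ∃ K : ℝ, 0 ≤ K ∧ ∀ (P : Params), P.d = 3 → ∀ (ρ : ℕ), 1 ≤ ρ → 8 * ρ ≤ P.sitesPerDir 0 →
      ∀ (M : ℕ) (len start : Fin M → ℕ) (owner : ZMod (P.sitesPerDir 0) → Fin M),
        Even M → 8 ≤ M → (∀ i, ρ ≤ len i ∧ 3 * len i ≤ 4 * ρ + 3) → (∀ i : Fin M, (i : ℕ) = 0 → start i = 0) →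
        (∀ i j : Fin M, (j : ℕ) = (i : ℕ) + 1 → start j = start i + len i) → (∀ i : Fin M, (i : ℕ) + 1 = M → start i + len i = P.sitesPerDir 0) →
        (∀ v : ZMod (P.sitesPerDir 0), start (owner v) ≤ v.val ∧ v.val < start (owner v) + len (owner v)) →
      ∀ (g : (Fin P.d → Fin M) → Site P 0 → SU2) (η : ℝ), η * ρ ≤ 1 / 40 →
        (∀ (Q Q' : Fin P.d → Fin M) (b : PBond P 0),
          (∀ κ, (b.src κ - ((start (Q κ) : ℕ) : ZMod (P.sitesPerDir 0))).val ≤ len (Q κ)) →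
          (∀ κ, (b.tgt κ - ((start (Q κ) : ℕ) : ZMod (P.sitesPerDir 0))).val ≤ len (Q κ)) →
          (∀ κ, (b.src κ - ((start (Q' κ) : ℕ) : ZMod (P.sitesPerDir 0))).val ≤ len (Q' κ)) →
          (∀ κ, (b.tgt κ - ((start (Q' κ) : ℕ) : ZMod (P.sitesPerDir 0))).val ≤ len (Q' κ)) →
          dist1 ((g Q b.src * (g Q' b.src)⁻¹)⁻¹ * (g Q b.tgt * (g Q' b.tgt)⁻¹)) ≤ η) →
        ∃ w : (Fin P.d → Fin M) → Site P 0 → SU2,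
          (∀ (Q Q' : Fin P.d → Fin M) (x : Site P 0),
            (∀ κ, (x κ - ((start (Q κ) : ℕ) : ZMod (P.sitesPerDir 0))).val ≤ len (Q κ)) →
            (∀ κ, (x κ - ((start (Q' κ) : ℕ) : ZMod (P.sitesPerDir 0))).val ≤ len (Q' κ)) →
            w Q x * g Q x = w Q' x * g Q' x) ∧
          (∀ (Q : Fin P.d → Fin M) (b : PBond P 0),
            (∀ κ, (b.src κ - ((start (Q κ) : ℕ) : ZMod (P.sitesPerDir 0))).val ≤ len (Q κ)) →
            (∀ κ, (b.tgt κ - ((start (Q κ) : ℕ) : ZMod (P.sitesPerDir 0))).val ≤ len (Q κ)) →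
            dist1 (w Q b.src * (w Q b.tgt)⁻¹) ≤ K / ρ) := by
  classical
  -- the three letters at the chained scales `E₁ = 1∕40`, `E₂ = B₁ + 1∕40`, `E₃ = B₂ + 1∕40`
  obtain ⟨A₁, ρ₁, h₁⟩ := h₁
  obtain ⟨A₂, ρ₂, h₂⟩ := h₂ (max 0 A₁ + 1 / 40)
  obtain ⟨A₃, ρ₃, h₃⟩ := h₃ (max (max 0 A₁) A₂ + 1 / 40)
  obtain ⟨K₀, hK₀def⟩ : ∃ K₀ : ℝ, K₀ = max (max (max 0 A₁) A₂) A₃ := ⟨_, rfl⟩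
  obtain ⟨ρbar, hρbardef⟩ : ∃ ρbar : ℕ, ρbar = max (max ρ₁ ρ₂) (max ρ₃ 2) := ⟨_, rfl⟩
  have hB₁0 : (0 : ℝ) ≤ max 0 A₁ := le_max_left _ _
  have hB₂0 : (0 : ℝ) ≤ max (max 0 A₁) A₂ := le_trans hB₁0 (le_max_left _ _)
  have hK₀0 : 0 ≤ K₀ := by rw [hK₀def]; exact le_trans hB₂0 (le_max_left _ _)
  refine ⟨max K₀ (2 * ρbar), le_trans hK₀0 (le_max_left _ _), ?_⟩
  intro P hd ρ hρ hρN M len start owner hEven hM8 hlen hz hs hl hown g η hη hTrans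
  have hρpos : (0 : ℝ) < ρ := by exact_mod_cast hρ
  have hKdiv : K₀ / ρ ≤ max K₀ (2 * ρbar) / ρ := div_le_div_of_nonneg_right (le_max_left _ _) hρpos.le
  by_cases hsmall : ρ < ρbar
  · -- small scales: the trivial sections `w_Q := g_Q⁻¹`
    refine ⟨fun Q x => (g Q x)⁻¹, fun Q Q' x _ _ => by rw [inv_mul_cancel, inv_mul_cancel], fun Q b _ _ => ?_⟩
    have h2 : (2 : ℝ) ≤ max K₀ (2 * ρbar) / ρ := by
      rw [le_div_iff₀ hρpos]
      have : (ρ : ℝ) ≤ ρbar := by exact_mod_cast hsmall.le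
      calc (2 : ℝ) * ρ ≤ 2 * ρbar := by linarith
        _ ≤ max K₀ (2 * ρbar) := le_max_right _ _
    exact le_trans (dist1_le_two_specialUnitaryGroup _) h2
  -- large scales: the eight-colour gluing
  rw [not_lt, hρbardef] at hsmall
  have hρ₁ : ρ₁ ≤ ρ := le_trans (le_trans (le_max_left _ _) (le_max_left _ _)) hsmall
  have hρ₂ : ρ₂ ≤ ρ := le_trans (le_trans (le_max_right _ _) (le_max_left _ _)) hsmall
  have hρ₃ : ρ₃ ≤ ρ := le_trans (le_trans (le_max_left _ _) (le_max_right _ _)) hsmall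
  have hρ2 : 2 ≤ ρ := le_trans (le_trans (le_max_right _ _) (le_max_right _ _)) hsmall
  have hlen1 : ∀ i, 1 ≤ len i := fun i => le_trans hρ (hlen i).1
  have hlen2 : ∀ i, 2 ≤ len i := fun i => le_trans hρ2 (hlen i).1
  have hN : ∀ i, len i + 1 < P.sitesPerDir 0 := fun i => by have := (hlen i).2; omega
  have hM : 3 ≤ M := by omega
  -- the three axes
  obtain ⟨κ0, hκ0⟩ : ∃ κ0 : Fin P.d, (κ0 : ℕ) = 0 := ⟨⟨0, by omega⟩, rfl⟩
  obtain ⟨κ1, hκ1⟩ : ∃ κ1 : Fin P.d, (κ1 : ℕ) = 1 := ⟨⟨1, by omega⟩, rfl⟩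
  obtain ⟨κ2, hκ2⟩ : ∃ κ2 : Fin P.d, (κ2 : ℕ) = 2 := ⟨⟨2, by omega⟩, rfl⟩
  have htri : ∀ κ : Fin P.d, κ = κ0 ∨ κ = κ1 ∨ κ = κ2 := by
    intro κ
    have hκ := κ.isLt
    rcases Nat.lt_or_ge (κ : ℕ) 1 with h | h
    · exact Or.inl (Fin.ext (by omega))
    rcases Nat.lt_or_ge (κ : ℕ) 2 with h' | h'
    · exact Or.inr (Or.inl (Fin.ext (by omega)))
    · exact Or.inr (Or.inr (Fin.ext (by omega)))
  have h01 : κ0 ≠ κ1 := fun h => by have := congrArg Fin.val h; omega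
  have h02 : κ0 ≠ κ2 := fun h => by have := congrArg Fin.val h; omega
  have h12 : κ1 ≠ κ2 := fun h => by have := congrArg Fin.val h; omega
  -- the descent function
  obtain ⟨D, hD⟩ := exists_descentFun (N := P.sitesPerDir 0) len start
  -- the scales
  obtain ⟨ε₁, hε₁def⟩ : ∃ ε₁ : ℝ, ε₁ = max η 0 := ⟨_, rfl⟩
  obtain ⟨ε₂, hε₂def⟩ : ∃ ε₂ : ℝ, ε₂ = max 0 A₁ / ρ + max η 0 := ⟨_, rfl⟩
  obtain ⟨ε₃, hε₃def⟩ : ∃ ε₃ : ℝ, ε₃ = max (max 0 A₁) A₂ / ρ + max η 0 := ⟨_, rfl⟩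
  have hη0 : 0 ≤ max η 0 := le_max_right _ _
  have hηε : η ≤ max η 0 := le_max_left _ _
  have hηρ : max η 0 * ρ ≤ 1 / 40 := by
    rcases le_total η 0 with h | h
    · rw [max_eq_right h, zero_mul]; norm_num
    · rw [max_eq_left h]; exact hη
  have hε₁0 : 0 ≤ ε₁ := by rw [hε₁def]; exact hη0
  have hε₁E : ε₁ * ρ ≤ 1 / 40 := by rw [hε₁def]; exact hηρ
  have hε₂0 : 0 ≤ ε₂ := by rw [hε₂def]; exact add_nonneg (div_nonneg hB₁0 hρpos.le) hη0
  have hε₂E : ε₂ * ρ ≤ max 0 A₁ + 1 / 40 := by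
    rw [hε₂def, add_mul, div_mul_cancel₀ _ hρpos.ne']; linarith
  have hε₃0 : 0 ≤ ε₃ := by rw [hε₃def]; exact add_nonneg (div_nonneg hB₂0 hρpos.le) hη0
  have hε₃E : ε₃ * ρ ≤ max (max 0 A₁) A₂ + 1 / 40 := by
    rw [hε₃def, add_mul, div_mul_cancel₀ _ hρpos.ne']; linarith
  -- STAGE 1: datum, filling, table
  obtain ⟨ψ₁, hψ₁⟩ : ∃ ψ₁ : (Fin P.d → Fin M) → Site P 0 → SU2, ∀ Q x, ψ₁ Q x = g (fun κ => D (Q κ) (x κ)) x * (g Q x)⁻¹ := ⟨_, fun _ _ => rfl⟩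
  obtain ⟨W₁, hW₁⟩ : ∃ W₁ : (Fin P.d → Fin M) → Fin P.d → Site P 0 → SU2, ∀ (Q : Fin P.d → Fin M) (α : Fin P.d),
      (∀ x : Site P 0, (∀ κ, (x κ - ((start (Q κ) : ℕ) : ZMod (P.sitesPerDir 0))).val ≤ len (Q κ)) →
        ((x α - ((start (Q α) : ℕ) : ZMod (P.sitesPerDir 0))).val = 0 ∨ (x α - ((start (Q α) : ℕ) : ZMod (P.sitesPerDir 0))).val = len (Q α)) → W₁ Q α x = ψ₁ Q x) ∧
      ((0 ≤ ε₁ ∧ ε₁ * ρ ≤ 1 / 40 ∧ ∀ b : PBond P 0, (∀ κ, (b.src κ - ((start (Q κ) : ℕ) : ZMod (P.sitesPerDir 0))).val ≤ len (Q κ)) →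
          (∀ κ, (b.tgt κ - ((start (Q κ) : ℕ) : ZMod (P.sitesPerDir 0))).val ≤ len (Q κ)) →
          ((b.src α - ((start (Q α) : ℕ) : ZMod (P.sitesPerDir 0))).val = 0 ∨ (b.src α - ((start (Q α) : ℕ) : ZMod (P.sitesPerDir 0))).val = len (Q α)) →
          ((b.tgt α - ((start (Q α) : ℕ) : ZMod (P.sitesPerDir 0))).val = 0 ∨ (b.tgt α - ((start (Q α) : ℕ) : ZMod (P.sitesPerDir 0))).val = len (Q α)) →
          dist1 (ψ₁ Q b.src * (ψ₁ Q b.tgt)⁻¹) ≤ ε₁) →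
        ∀ b : PBond P 0, (∀ κ, (b.src κ - ((start (Q κ) : ℕ) : ZMod (P.sitesPerDir 0))).val ≤ len (Q κ)) →
          (∀ κ, (b.tgt κ - ((start (Q κ) : ℕ) : ZMod (P.sitesPerDir 0))).val ≤ len (Q κ)) →
          dist1 (W₁ Q α b.src * (W₁ Q α b.tgt)⁻¹) ≤ A₁ / ρ) :=
    ⟨fun Q α => Classical.choose (h₁ P hd ρ hρ₁ hρN (fun κ => len (Q κ)) (fun κ => start (Q κ)) (fun κ => hlen (Q κ)) α (ψ₁ Q) ε₁),
      fun Q α => Classical.choose_spec (h₁ P hd ρ hρ₁ hρN (fun κ => len (Q κ)) (fun κ => start (Q κ)) (fun κ => hlen (Q κ)) α (ψ₁ Q) ε₁)⟩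
  obtain ⟨wle1, hwle1⟩ : ∃ wle1 : (Fin P.d → Fin M) → Site P 0 → SU2, ∀ R x, wle1 R x =
      if ((R κ0 : Fin M) : ℕ) % 2 = 1 then (if ((R κ1 : Fin M) : ℕ) % 2 = 1 then 1 else if ((R κ2 : Fin M) : ℕ) % 2 = 1 then 1 else W₁ R κ0 x)
        else (if ((R κ1 : Fin M) : ℕ) % 2 = 1 then (if ((R κ2 : Fin M) : ℕ) % 2 = 1 then 1 else W₁ R κ1 x)
          else (if ((R κ2 : Fin M) : ℕ) % 2 = 1 then W₁ R κ2 x else 1)) := ⟨_, fun _ _ => rfl⟩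
  -- STAGE 2
  obtain ⟨ψ₂, hψ₂⟩ : ∃ ψ₂ : (Fin P.d → Fin M) → Site P 0 → SU2, ∀ Q x, ψ₂ Q x = wle1 (fun κ => D (Q κ) (x κ)) x * g (fun κ => D (Q κ) (x κ)) x * (g Q x)⁻¹ :=
    ⟨_, fun _ _ => rfl⟩
  obtain ⟨W₂, hW₂⟩ : ∃ W₂ : (Fin P.d → Fin M) → Fin P.d → Fin P.d → Site P 0 → SU2, ∀ (Q : Fin P.d → Fin M) (α β : Fin P.d),
      (∀ x : Site P 0, (∀ κ, (x κ - ((start (Q κ) : ℕ) : ZMod (P.sitesPerDir 0))).val ≤ len (Q κ)) →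
        (((x α - ((start (Q α) : ℕ) : ZMod (P.sitesPerDir 0))).val = 0 ∨ (x α - ((start (Q α) : ℕ) : ZMod (P.sitesPerDir 0))).val = len (Q α)) ∨
          ((x β - ((start (Q β) : ℕ) : ZMod (P.sitesPerDir 0))).val = 0 ∨ (x β - ((start (Q β) : ℕ) : ZMod (P.sitesPerDir 0))).val = len (Q β))) → W₂ Q α β x = ψ₂ Q x) ∧
      ((α ≠ β ∧ 0 ≤ ε₂ ∧ ε₂ * ρ ≤ max 0 A₁ + 1 / 40 ∧ ∀ b : PBond P 0, (∀ κ, (b.src κ - ((start (Q κ) : ℕ) : ZMod (P.sitesPerDir 0))).val ≤ len (Q κ)) →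
          (∀ κ, (b.tgt κ - ((start (Q κ) : ℕ) : ZMod (P.sitesPerDir 0))).val ≤ len (Q κ)) →
          (((b.src α - ((start (Q α) : ℕ) : ZMod (P.sitesPerDir 0))).val = 0 ∨ (b.src α - ((start (Q α) : ℕ) : ZMod (P.sitesPerDir 0))).val = len (Q α)) ∨
            ((b.src β - ((start (Q β) : ℕ) : ZMod (P.sitesPerDir 0))).val = 0 ∨ (b.src β - ((start (Q β) : ℕ) : ZMod (P.sitesPerDir 0))).val = len (Q β))) →
          (((b.tgt α - ((start (Q α) : ℕ) : ZMod (P.sitesPerDir 0))).val = 0 ∨ (b.tgt α - ((start (Q α) : ℕ) : ZMod (P.sitesPerDir 0))).val = len (Q α)) ∨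
            ((b.tgt β - ((start (Q β) : ℕ) : ZMod (P.sitesPerDir 0))).val = 0 ∨ (b.tgt β - ((start (Q β) : ℕ) : ZMod (P.sitesPerDir 0))).val = len (Q β))) →
          dist1 (ψ₂ Q b.src * (ψ₂ Q b.tgt)⁻¹) ≤ ε₂) →
        ∀ b : PBond P 0, (∀ κ, (b.src κ - ((start (Q κ) : ℕ) : ZMod (P.sitesPerDir 0))).val ≤ len (Q κ)) →
          (∀ κ, (b.tgt κ - ((start (Q κ) : ℕ) : ZMod (P.sitesPerDir 0))).val ≤ len (Q κ)) →
          dist1 (W₂ Q α β b.src * (W₂ Q α β b.tgt)⁻¹) ≤ A₂ / ρ) :=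
    ⟨fun Q α β => Classical.choose (h₂ P hd ρ hρ₂ hρN (fun κ => len (Q κ)) (fun κ => start (Q κ)) (fun κ => hlen (Q κ)) α β (ψ₂ Q) ε₂),
      fun Q α β => Classical.choose_spec (h₂ P hd ρ hρ₂ hρN (fun κ => len (Q κ)) (fun κ => start (Q κ)) (fun κ => hlen (Q κ)) α β (ψ₂ Q) ε₂)⟩
  obtain ⟨wle2, hwle2⟩ : ∃ wle2 : (Fin P.d → Fin M) → Site P 0 → SU2, ∀ R x, wle2 R x =
      if ((R κ0 : Fin M) : ℕ) % 2 = 1 then (if ((R κ1 : Fin M) : ℕ) % 2 = 1 then (if ((R κ2 : Fin M) : ℕ) % 2 = 1 then 1 else W₂ R κ0 κ1 x)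
          else (if ((R κ2 : Fin M) : ℕ) % 2 = 1 then W₂ R κ0 κ2 x else W₁ R κ0 x))
        else (if ((R κ1 : Fin M) : ℕ) % 2 = 1 then (if ((R κ2 : Fin M) : ℕ) % 2 = 1 then W₂ R κ1 κ2 x else W₁ R κ1 x)
          else (if ((R κ2 : Fin M) : ℕ) % 2 = 1 then W₁ R κ2 x else 1)) := ⟨_, fun _ _ => rfl⟩
  -- STAGE 3
  obtain ⟨ψ₃, hψ₃⟩ : ∃ ψ₃ : (Fin P.d → Fin M) → Site P 0 → SU2, ∀ Q x, ψ₃ Q x = wle2 (fun κ => D (Q κ) (x κ)) x * g (fun κ => D (Q κ) (x κ)) x * (g Q x)⁻¹ :=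
    ⟨_, fun _ _ => rfl⟩
  obtain ⟨W₃, hW₃⟩ : ∃ W₃ : (Fin P.d → Fin M) → Site P 0 → SU2, ∀ (Q : Fin P.d → Fin M),
      (∀ x : Site P 0, (∀ κ, (x κ - ((start (Q κ) : ℕ) : ZMod (P.sitesPerDir 0))).val ≤ len (Q κ)) →
        (∃ κ, (x κ - ((start (Q κ) : ℕ) : ZMod (P.sitesPerDir 0))).val = 0 ∨ (x κ - ((start (Q κ) : ℕ) : ZMod (P.sitesPerDir 0))).val = len (Q κ)) → W₃ Q x = ψ₃ Q x) ∧
      ((0 ≤ ε₃ ∧ ε₃ * ρ ≤ max (max 0 A₁) A₂ + 1 / 40 ∧ ∀ b : PBond P 0, (∀ κ, (b.src κ - ((start (Q κ) : ℕ) : ZMod (P.sitesPerDir 0))).val ≤ len (Q κ)) →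
          (∀ κ, (b.tgt κ - ((start (Q κ) : ℕ) : ZMod (P.sitesPerDir 0))).val ≤ len (Q κ)) →
          (∃ κ, (b.src κ - ((start (Q κ) : ℕ) : ZMod (P.sitesPerDir 0))).val = 0 ∨ (b.src κ - ((start (Q κ) : ℕ) : ZMod (P.sitesPerDir 0))).val = len (Q κ)) →
          (∃ κ, (b.tgt κ - ((start (Q κ) : ℕ) : ZMod (P.sitesPerDir 0))).val = 0 ∨ (b.tgt κ - ((start (Q κ) : ℕ) : ZMod (P.sitesPerDir 0))).val = len (Q κ)) →
          dist1 (ψ₃ Q b.src * (ψ₃ Q b.tgt)⁻¹) ≤ ε₃) →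
        ∀ b : PBond P 0, (∀ κ, (b.src κ - ((start (Q κ) : ℕ) : ZMod (P.sitesPerDir 0))).val ≤ len (Q κ)) →
          (∀ κ, (b.tgt κ - ((start (Q κ) : ℕ) : ZMod (P.sitesPerDir 0))).val ≤ len (Q κ)) →
          dist1 (W₃ Q b.src * (W₃ Q b.tgt)⁻¹) ≤ A₃ / ρ) :=
    ⟨fun Q => Classical.choose (h₃ P hd ρ hρ₃ hρN (fun κ => len (Q κ)) (fun κ => start (Q κ)) (fun κ => hlen (Q κ)) (ψ₃ Q) ε₃),
      fun Q => Classical.choose_spec (h₃ P hd ρ hρ₃ hρN (fun κ => len (Q κ)) (fun κ => start (Q κ)) (fun κ => hlen (Q κ)) (ψ₃ Q) ε₃)⟩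
  obtain ⟨w, hw⟩ : ∃ w : (Fin P.d → Fin M) → Site P 0 → SU2, ∀ R x, w R x =
      if ((R κ0 : Fin M) : ℕ) % 2 = 1 then (if ((R κ1 : Fin M) : ℕ) % 2 = 1 then (if ((R κ2 : Fin M) : ℕ) % 2 = 1 then W₃ R x else W₂ R κ0 κ1 x)
          else (if ((R κ2 : Fin M) : ℕ) % 2 = 1 then W₂ R κ0 κ2 x else W₁ R κ0 x))
        else (if ((R κ1 : Fin M) : ℕ) % 2 = 1 then (if ((R κ2 : Fin M) : ℕ) % 2 = 1 then W₂ R κ1 κ2 x else W₁ R κ1 x)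
          else (if ((R κ2 : Fin M) : ℕ) % 2 = 1 then W₁ R κ2 x else 1)) := ⟨_, fun _ _ => rfl⟩
  obtain ⟨st, hst⟩ : ∃ st : (Fin P.d → Fin M) → ℕ, ∀ R, st R = (if ((R κ0 : Fin M) : ℕ) % 2 = 1 then 1 else 0) +
      (if ((R κ1 : Fin M) : ℕ) % 2 = 1 then 1 else 0) + (if ((R κ2 : Fin M) : ℕ) % 2 = 1 then 1 else 0) := ⟨_, fun _ => rfl⟩
  -- the agreement clauses in the table's currency
  have hA1 : ∀ (Q : Fin P.d → Fin M) (α : Fin P.d) (x : Site P 0), (∀ κ, (x κ - ((start (Q κ) : ℕ) : ZMod (P.sitesPerDir 0))).val ≤ len (Q κ)) →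
      ((x α - ((start (Q α) : ℕ) : ZMod (P.sitesPerDir 0))).val = 0 ∨ (x α - ((start (Q α) : ℕ) : ZMod (P.sitesPerDir 0))).val = len (Q α)) →
      W₁ Q α x = g (fun κ => D (Q κ) (x κ)) x * (g Q x)⁻¹ := fun Q α x hx hf => by rw [(hW₁ Q α).1 x hx hf, hψ₁]
  have hA2 : ∀ (Q : Fin P.d → Fin M) (α β : Fin P.d) (x : Site P 0), (∀ κ, (x κ - ((start (Q κ) : ℕ) : ZMod (P.sitesPerDir 0))).val ≤ len (Q κ)) →
      (((x α - ((start (Q α) : ℕ) : ZMod (P.sitesPerDir 0))).val = 0 ∨ (x α - ((start (Q α) : ℕ) : ZMod (P.sitesPerDir 0))).val = len (Q α)) ∨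
        ((x β - ((start (Q β) : ℕ) : ZMod (P.sitesPerDir 0))).val = 0 ∨ (x β - ((start (Q β) : ℕ) : ZMod (P.sitesPerDir 0))).val = len (Q β))) →
      W₂ Q α β x = wle1 (fun κ => D (Q κ) (x κ)) x * g (fun κ => D (Q κ) (x κ)) x * (g Q x)⁻¹ := fun Q α β x hx hf => by rw [(hW₂ Q α β).1 x hx hf, hψ₂]
  have hA3 : ∀ (Q : Fin P.d → Fin M) (x : Site P 0), (∀ κ, (x κ - ((start (Q κ) : ℕ) : ZMod (P.sitesPerDir 0))).val ≤ len (Q κ)) →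
      (∃ κ, (x κ - ((start (Q κ) : ℕ) : ZMod (P.sitesPerDir 0))).val = 0 ∨ (x κ - ((start (Q κ) : ℕ) : ZMod (P.sitesPerDir 0))).val = len (Q κ)) →
      W₃ Q x = wle2 (fun κ => D (Q κ) (x κ)) x * g (fun κ => D (Q κ) (x κ)) x * (g Q x)⁻¹ := fun Q x hx hf => by rw [(hW₃ Q).1 x hx hf, hψ₃]
  -- (CONS)
  refine ⟨w, fun Q Q' x hx hx' => cons len start hlen1 hz hs hl hM hEven D hD κ0 κ1 κ2 htri g W₁ W₂ W₃ wle1 wle2 w hwle1 hwle2 hw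
    hA1 hA2 hA3 Q Q' x hx hx', ?_⟩
  -- (STEP) by three rounds
  have S0 : ∀ R : Fin P.d → Fin M, st R = 0 → ∀ b : PBond P 0, dist1 (w R b.src * (w R b.tgt)⁻¹) ≤ 0 := fun R hR b =>
    (step_stage0 κ0 κ1 κ2 W₁ W₂ W₃ w hw st hst R hR b.src b.tgt).le
  have S1 : ∀ R : Fin P.d → Fin M, st R = 1 → ∀ b : PBond P 0, (∀ κ, (b.src κ - ((start (R κ) : ℕ) : ZMod (P.sitesPerDir 0))).val ≤ len (R κ)) →
      (∀ κ, (b.tgt κ - ((start (R κ) : ℕ) : ZMod (P.sitesPerDir 0))).val ≤ len (R κ)) → dist1 (w R b.src * (w R b.tgt)⁻¹) ≤ A₁ / ρ :=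
    fun R hR b hbs hbt => step_stage1 len start hlen1 hz hs hl hM hEven D hD κ0 κ1 κ2 htri g W₁ W₂ W₃ wle1 wle2 w hwle1 hwle2 hw hA1 hA2 hA3
      st hst hlen2 hN hTrans (fun Q α hlip => (hW₁ Q α).2 ⟨hε₁0, hε₁E, fun b' hs' ht' hfs hft => by
        rw [hψ₁, hψ₁]; exact hlip b' hs' ht' hfs hft⟩) (hε₁def ▸ hηε) R hR b hbs hbt
  have low2 : ∀ R : Fin P.d → Fin M, st R < 2 → ∀ b : PBond P 0, (∀ κ, (b.src κ - ((start (R κ) : ℕ) : ZMod (P.sitesPerDir 0))).val ≤ len (R κ)) →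
      (∀ κ, (b.tgt κ - ((start (R κ) : ℕ) : ZMod (P.sitesPerDir 0))).val ≤ len (R κ)) → dist1 (w R b.src * (w R b.tgt)⁻¹) ≤ max 0 A₁ / ρ := by
    intro R hR b hbs hbt
    rcases Nat.lt_or_ge (st R) 1 with h | h
    · exact le_trans (S0 R (by omega) b) (div_nonneg hB₁0 hρpos.le)
    · exact le_trans (S1 R (by omega) b hbs hbt) (div_le_div_of_nonneg_right (le_max_right _ _) hρpos.le)
  have S2 : ∀ R : Fin P.d → Fin M, st R = 2 → ∀ b : PBond P 0, (∀ κ, (b.src κ - ((start (R κ) : ℕ) : ZMod (P.sitesPerDir 0))).val ≤ len (R κ)) →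
      (∀ κ, (b.tgt κ - ((start (R κ) : ℕ) : ZMod (P.sitesPerDir 0))).val ≤ len (R κ)) → dist1 (w R b.src * (w R b.tgt)⁻¹) ≤ A₂ / ρ :=
    fun R hR b hbs hbt => step_stage2 len start hlen1 hz hs hl hM hEven D hD κ0 κ1 κ2 htri g W₁ W₂ W₃ wle1 wle2 w hwle1 hwle2 hw hA1 hA2 hA3
      st hst hlen2 hN h01 h02 h12 hTrans (fun Q α β hne hlip => (hW₂ Q α β).2 ⟨hne, hε₂0, hε₂E, fun b' hs' ht' hfs hft => by
        rw [hψ₂, hψ₂]; exact hlip b' hs' ht' hfs hft⟩) low2 (by rw [hε₂def]; linarith) R hR b hbs hbt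
  have low3 : ∀ R : Fin P.d → Fin M, st R < 3 → ∀ b : PBond P 0, (∀ κ, (b.src κ - ((start (R κ) : ℕ) : ZMod (P.sitesPerDir 0))).val ≤ len (R κ)) →
      (∀ κ, (b.tgt κ - ((start (R κ) : ℕ) : ZMod (P.sitesPerDir 0))).val ≤ len (R κ)) → dist1 (w R b.src * (w R b.tgt)⁻¹) ≤ max (max 0 A₁) A₂ / ρ := by
    intro R hR b hbs hbt
    rcases Nat.lt_or_ge (st R) 2 with h | h
    · exact le_trans (low2 R h b hbs hbt) (div_le_div_of_nonneg_right (le_max_left _ _) hρpos.le)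
    · exact le_trans (S2 R (by omega) b hbs hbt) (div_le_div_of_nonneg_right (le_max_right _ _) hρpos.le)
  have S3 : ∀ R : Fin P.d → Fin M, st R = 3 → ∀ b : PBond P 0, (∀ κ, (b.src κ - ((start (R κ) : ℕ) : ZMod (P.sitesPerDir 0))).val ≤ len (R κ)) →
      (∀ κ, (b.tgt κ - ((start (R κ) : ℕ) : ZMod (P.sitesPerDir 0))).val ≤ len (R κ)) → dist1 (w R b.src * (w R b.tgt)⁻¹) ≤ A₃ / ρ :=
    fun R hR b hbs hbt => step_stage3 len start hlen1 hz hs hl hM hEven D hD κ0 κ1 κ2 htri g W₁ W₂ W₃ wle1 wle2 w hwle1 hwle2 hw hA1 hA2 hA3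
      st hst hlen2 hN hTrans (fun Q hlip => (hW₃ Q).2 ⟨hε₃0, hε₃E, fun b' hs' ht' hfs hft => by
        rw [hψ₃, hψ₃]; exact hlip b' hs' ht' hfs hft⟩) low3 (by rw [hε₃def]; linarith) R hR b hbs hbt
  intro Q b hbs hbt
  refine le_trans ?_ hKdiv
  have h3 := st_le_three κ0 κ1 κ2 st hst Q
  rcases Nat.lt_or_ge (st Q) 3 with h | h
  · exact le_trans (low3 Q h b hbs hbt) (div_le_div_of_nonneg_right (by rw [hK₀def]; exact le_max_left _ _) hρpos.le)
  · exact le_trans (S3 Q (by omega) b hbs hbt) (div_le_div_of_nonneg_right (by rw [hK₀def]; exact le_max_right _ _) hρpos.le)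

end Summit.QuantumFields.YangMills.Theorems.FluctuationComparisonRegPrIntLS2BetaSectionsOfFillings
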